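import Summits.KontsevichZagierPeriods.Zeta5Search.Zudilin2002CasoratianSharp
import Summits.KontsevichZagierPeriods.Zeta5Search.Zudilin2002Approximants
import Summits.KontsevichZagierPeriods.Zeta5Search.TailSqueeze
import HarnessLib

/-!
# ζ(5) search — Zudilin 2002: EXACT Casoratian rate and the exact approximation rate `e^{-8.86 n}` (cell `pub-zeta5`, TYPER)

HONEST FRAMING: systematic search; no irrationality claim unless certified.

Poincaré's theorem (order 3, `Literature.Analysis.Asymptotics.PoincareRecurrence`) applied to the
Casoratian recursion of Zudilin's `ζ(5)` recursion, on the sharp box of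
`Zudilin2002CasoratianSharp.lean` (`195 ≤ Z_{n+1}/Zₙ ≤ 1045`, `n ≥ 3`):

* `tendsto_aZ`, `tendsto_bZ`, `tendsto_cZ` — the coefficients tend to `752, 37888, -256`; the limiting
  equation `y³ = 752y² + 37888y - 256` is the second compound of Zudilin's characteristic polynomial
  (roots `-λᵢλⱼ`, `λᵢ = -μᵢ`); `casChar_root` — it has a root `ν ∈ (799.39, 799.40)` (IVT;
  `ν = μ₂|μ₃| = 799.3954…`);
* `tendsto_ratio_Z`, `tendsto_log_Z_div` — `Z_{n+1}/Zₙ → ν`, `log Zₙ/n → log ν` (contraction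
  `37888/195² + 512/195³ = 0.9965 < 1`); the same for the `ζ(3)`-Casoratian `Zt`;
* `tendsto_log_abs_step_div` — the steps of the approximants satisfy
  `log|p_{n+1}/q_{n+1} - pₙ/qₙ|/n → log ν - 2 log|μ₃| = -8.856014…` (true rate, replacing the certified
  but crude `-6.41` of `Zudilin2002Approximants`);
* for THE LIMIT `L` of `pₙ/qₙ` (it exists unconditionally: `exists_limit`; `= ζ(5)` is Zudilin's
  Theorem 1): `tendsto_log_abs_sub_div_of_tendsto` — `log|L - pₙ/qₙ|/n → log ν - 2 log|μ₃|` (tail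
  squeeze, `θ = 1045/796²`), `form_ne_zero_of_tendsto` — `qₙL - pₙ ≠ 0` (`n ≥ 2`), and
  `tendsto_log_abs_form_div_of_tendsto` — `log|qₙL - pₙ|/n → log ν - log|μ₃| = -1.08608…`
  (`= log μ₂`; the identification `ν/|μ₃| = μ₂` with THE root `μ₂` of Zudilin's (5) is algebra on the
  three roots, done in `Zudilin2002Decay.lean`); and the `ζ(3)`-side analogues with `p̃ₙ`, `Zt`.

Everything is PROVED (0 sorry); no analytic input beyond the tree's definitions.
-/

noncomputable section

open Filter Topology Finset Set
open Literature.NumberTheory.Irrationality.Zudilin2002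
open Literature.Analysis.Asymptotics.PoincareRecurrence

namespace Summit.KontsevichZagierPeriods.Zeta5Search

namespace Zudilin2002Growth

/-! ### Limits of the Casoratian coefficients -/

/-- `a'_m = B_{m+1} → 752`. -/
theorem tendsto_aZ : Tendsto aZ atTop (𝓝 752) := tendsto_B.comp (tendsto_add_atTop_nat 1)

/-- `b'_m = -A_m C_{m+1} → -(2368 · (-16)) = 37888`. -/
theorem tendsto_bZ : Tendsto bZ atTop (𝓝 37888) := by
  have h := (tendsto_A.mul (tendsto_C.comp (tendsto_add_atTop_nat 1))).neg
  rw [show -((2368 : ℝ) * -16) = 37888 by norm_num] at h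
  exact h

/-- `c'_m = -C_m C_{m+1} → -256`. -/
theorem tendsto_cZ : Tendsto cZ atTop (𝓝 (-256)) := by
  have h := (tendsto_C.mul (tendsto_C.comp (tendsto_add_atTop_nat 1))).neg
  rw [show -((-16 : ℝ) * -16) = -256 by norm_num] at h
  exact h

/-- **The dominant Casoratian root**: `y³ = 752y² + 37888y - 256` has a root `ν ∈ (799.39, 799.40)`
(`ν = μ₂|μ₃|`; intermediate value theorem). -/
theorem casChar_root : ∃ ν : ℝ, ν ∈ Ioo (79939 / 100 : ℝ) (79940 / 100) ∧
    ν ^ 3 = 752 * ν ^ 2 + 37888 * ν + (-256) := by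
  have hcont : Continuous (fun y : ℝ => y ^ 3 - 752 * y ^ 2 - 37888 * y + 256) := by fun_prop
  have hab : (79939 / 100 : ℝ) ≤ 79940 / 100 := by norm_num
  have ha : (79939 / 100 : ℝ) ^ 3 - 752 * (79939 / 100) ^ 2 - 37888 * (79939 / 100) + 256 < 0 := by
    norm_num
  have hb : (0 : ℝ) < (79940 / 100 : ℝ) ^ 3 - 752 * (79940 / 100) ^ 2 - 37888 * (79940 / 100) + 256 := by
    norm_num
  obtain ⟨x, hx, hx0⟩ := intermediate_value_Ioo hab hcont.continuousOn ⟨ha, hb⟩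
  exact ⟨x, hx, by simp only at hx0; linarith⟩

/-! ### Poincaré on the Casoratian -/

/-- **`Z_{n+1}/Zₙ → ν`** for every root `ν ≥ 195` of the limiting Casoratian equation. -/
theorem tendsto_ratio_Z {ν : ℝ} (hν : ν ^ 3 = 752 * ν ^ 2 + 37888 * ν + (-256)) (hge : 195 ≤ ν) :
    Tendsto (fun n => Z (n + 1) / Z n) atTop (𝓝 ν) := by
  refine tendsto_ratio_of_recurrence₃ Z aZ bZ cZ (L := 195) 3 (fun m _ => Z_rec m) tendsto_aZ
    tendsto_bZ tendsto_cZ (by norm_num) (fun n hn => (Z_ratio_bounds_sharp n hn).1.ne')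
    (fun n hn => ?_) hν hge (by norm_num)
  obtain ⟨hpos, hle, -⟩ := Z_ratio_bounds_sharp n hn
  rwa [le_div_iff₀ hpos]

/-- **`Zt_{n+1}/Ztₙ → ν`** likewise for the `ζ(3)`-Casoratian. -/
theorem tendsto_ratio_Zt {ν : ℝ} (hν : ν ^ 3 = 752 * ν ^ 2 + 37888 * ν + (-256)) (hge : 195 ≤ ν) :
    Tendsto (fun n => Zt (n + 1) / Zt n) atTop (𝓝 ν) := by
  refine tendsto_ratio_of_recurrence₃ Zt aZ bZ cZ (L := 195) 3 (fun m _ => Zt_rec m) tendsto_aZ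
    tendsto_bZ tendsto_cZ (by norm_num) (fun n hn => (Zt_ratio_bounds n hn).1.ne')
    (fun n hn => ?_) hν hge (by norm_num)
  obtain ⟨hpos, hle, -⟩ := Zt_ratio_bounds n hn
  rwa [le_div_iff₀ hpos]

/-- The root `≥ 195` is unique (two such roots are both the limit of `Z_{n+1}/Zₙ`). -/
theorem casChar_root_unique {ν ν' : ℝ} (hν : ν ^ 3 = 752 * ν ^ 2 + 37888 * ν + (-256)) (hge : 195 ≤ ν)
    (hν' : ν' ^ 3 = 752 * ν' ^ 2 + 37888 * ν' + (-256)) (hge' : 195 ≤ ν') : ν = ν' :=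
  tendsto_nhds_unique (tendsto_ratio_Z hν hge) (tendsto_ratio_Z hν' hge')

/-- **Exact rate of the Casoratian**: `log Zₙ / n → log ν`. -/
theorem tendsto_log_Z_div {ν : ℝ} (hν : ν ^ 3 = 752 * ν ^ 2 + 37888 * ν + (-256)) (hge : 195 ≤ ν) :
    Tendsto (fun n : ℕ => Real.log (Z n) / n) atTop (𝓝 (Real.log ν)) := by
  have h := tendsto_log_abs_div_of_tendsto_ratio Z 3 (fun n hn => (Z_ratio_bounds_sharp n hn).1.ne')
    (by linarith : ν ≠ 0) (tendsto_ratio_Z hν hge)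
  rw [abs_of_pos (by linarith : (0 : ℝ) < ν)] at h
  refine h.congr' ?_
  filter_upwards [eventually_ge_atTop 3] with n hn
  rw [abs_of_pos (Z_ratio_bounds_sharp n hn).1]

/-- **Exact rate of the `ζ(3)`-Casoratian**: `log Ztₙ / n → log ν`. -/
theorem tendsto_log_Zt_div {ν : ℝ} (hν : ν ^ 3 = 752 * ν ^ 2 + 37888 * ν + (-256)) (hge : 195 ≤ ν) :
    Tendsto (fun n : ℕ => Real.log (Zt n) / n) atTop (𝓝 (Real.log ν)) := by
  have h := tendsto_log_abs_div_of_tendsto_ratio Zt 3 (fun n hn => (Zt_ratio_bounds n hn).1.ne')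
    (by linarith : ν ≠ 0) (tendsto_ratio_Zt hν hge)
  rw [abs_of_pos (by linarith : (0 : ℝ) < ν)] at h
  refine h.congr' ?_
  filter_upwards [eventually_ge_atTop 3] with n hn
  rw [abs_of_pos (Zt_ratio_bounds n hn).1]

/-! ### The growth of `|qₙ|` with a shifted index -/

/-- `log|q_{n+1}|/n → log|μ|` for every root `μ ≤ -796` of (5). -/
theorem tendsto_log_abs_q_succ_div {μ : ℝ} (hμ : charPoly μ = 0) (hle : μ ≤ -796) :
    Tendsto (fun n : ℕ => Real.log |(q (n + 1) : ℝ)| / n) atTop (𝓝 (Real.log |μ|)) := by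
  have h1 : Tendsto (fun n : ℕ => Real.log (u (n + 1) / u n)) atTop (𝓝 (Real.log (-μ))) :=
    (tendsto_ratio_u hμ hle).log (by linarith)
  have h2 : Tendsto (fun n : ℕ => Real.log (u (n + 1) / u n) / n) atTop (𝓝 0) :=
    h1.div_atTop tendsto_natCast_atTop_atTop
  have h3 := (tendsto_log_abs_q_div hμ hle).add h2
  rw [add_zero] at h3
  refine h3.congr' ?_
  filter_upwards [eventually_ge_atTop 2] with n hn
  have hu0 := (ratio_bounds n hn).1
  have hu1 := (ratio_bounds (n + 1) (by omega)).1
  rw [← add_div, abs_q_eq_u n hn, abs_q_eq_u (n + 1) (by omega), Real.log_div hu1.ne' hu0.ne']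
  ring

/-! ### The approximants `pₙ/qₙ`: exact step rate, tail squeeze -/

/-- **Exact rate of the steps**: `log|p_{n+1}/q_{n+1} - pₙ/qₙ|/n → log ν - 2 log|μ|`. -/
theorem tendsto_log_abs_step_div {ν : ℝ} (hν : ν ^ 3 = 752 * ν ^ 2 + 37888 * ν + (-256)) (hge : 195 ≤ ν)
    {μ : ℝ} (hμ : charPoly μ = 0) (hle : μ ≤ -796) :
    Tendsto (fun n : ℕ => Real.log |(p (n + 1) : ℝ) / q (n + 1) - (p n : ℝ) / q n| / n) atTop
      (𝓝 (Real.log ν - 2 * Real.log |μ|)) := by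
  have h := ((tendsto_log_Z_div hν hge).sub (tendsto_log_abs_q_div hμ hle)).sub
    (tendsto_log_abs_q_succ_div hμ hle)
  have e : Real.log ν - Real.log |μ| - Real.log |μ| = Real.log ν - 2 * Real.log |μ| := by ring
  rw [e] at h
  refine h.congr' ?_
  filter_upwards [eventually_ge_atTop 3] with n hn
  have hZ := (Z_ratio_bounds_sharp n hn).1
  have hq0 : 0 < |(q n : ℝ)| := by rw [abs_q_eq_u n (by omega)]; exact (ratio_bounds n (by omega)).1
  have hq1 : 0 < |(q (n + 1) : ℝ)| := by
    rw [abs_q_eq_u (n + 1) (by omega)]; exact (ratio_bounds (n + 1) (by omega)).1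
  rw [abs_ratio_step_eq n (by omega), Real.log_div hZ.ne' (mul_pos hq0 hq1).ne', Real.log_mul hq0.ne' hq1.ne']
  ring

/-- **The steps contract**: `|p_{k+2}/q_{k+2} - p_{k+1}/q_{k+1}| ≤ (1045/796²)|p_{k+1}/q_{k+1} - p_k/q_k|`
for `k ≥ 2` (Casoratian box `≤ 1045`, growth box `≥ 796` twice). -/
theorem step_contraction (k : ℕ) (hk : 2 ≤ k) :
    |(p (k + 2) : ℝ) / q (k + 2) - (p (k + 1) : ℝ) / q (k + 1)| ≤
      1045 / 796 ^ 2 * |(p (k + 1) : ℝ) / q (k + 1) - (p k : ℝ) / q k| := by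
  have hZ := Z_ratio_bounds k hk
  have hq0 : 0 < |(q k : ℝ)| := by rw [abs_q_eq_u k hk]; exact (ratio_bounds k hk).1
  have hq1 : 0 < |(q (k + 1) : ℝ)| := by rw [abs_q_eq_u (k + 1) (by omega)]; exact (ratio_bounds (k + 1) (by omega)).1
  have hq2 : 0 < |(q (k + 2) : ℝ)| := by rw [abs_q_eq_u (k + 2) (by omega)]; exact (ratio_bounds (k + 2) (by omega)).1
  have hg1 := (abs_q_succ_bounds k hk).1
  have hg2 := (abs_q_succ_bounds (k + 1) (by omega)).1
  rw [show k + 1 + 1 = k + 2 by ring] at hg2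
  have hq2' : (796 : ℝ) ^ 2 * |(q k : ℝ)| ≤ |(q (k + 2) : ℝ)| := by nlinarith
  rw [show k + 2 = k + 1 + 1 by ring, abs_ratio_step_eq (k + 1) (by omega), abs_ratio_step_eq k hk,
    show k + 1 + 1 = k + 2 by ring]
  -- `Z(k+1)/(|q(k+1)||q(k+2)|) ≤ 1045 Z k /(|q(k+1)| 796² |q k|)`
  calc Z (k + 1) / (|(q (k + 1) : ℝ)| * |(q (k + 2) : ℝ)|)
      ≤ 1045 * Z k / (|(q (k + 1) : ℝ)| * ((796 : ℝ) ^ 2 * |(q k : ℝ)|)) :=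
        div_le_div₀ (by linarith [hZ.1]) hZ.2.2 (by positivity) (mul_le_mul_of_nonneg_left hq2' hq1.le)
    _ = 1045 / 796 ^ 2 * (Z k / (|(q k : ℝ)| * |(q (k + 1) : ℝ)|)) := by
        field_simp

/-- The steps do not vanish (`n ≥ 2`). -/
theorem step_ne_zero (k : ℕ) (hk : 2 ≤ k) : (p (k + 1) : ℝ) / q (k + 1) ≠ (p k : ℝ) / q k := by
  intro h
  have h1 := abs_ratio_step_eq k hk
  rw [h, sub_self, abs_zero] at h1
  have hZ := (Z_ratio_bounds k hk).1
  have hq0 : 0 < |(q k : ℝ)| := by rw [abs_q_eq_u k hk]; exact (ratio_bounds k hk).1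
  have hq1 : 0 < |(q (k + 1) : ℝ)| := by rw [abs_q_eq_u (k + 1) (by omega)]; exact (ratio_bounds (k + 1) (by omega)).1
  have : 0 < Z k / (|(q k : ℝ)| * |(q (k + 1) : ℝ)|) := div_pos hZ (mul_pos hq0 hq1)
  linarith

variable {L : ℝ}

/-- **Non-vanishing**: if `pₙ/qₙ → L` then `qₙL - pₙ ≠ 0` for every `n ≥ 2`. -/
theorem form_ne_zero_of_tendsto (hL : Tendsto (fun n : ℕ => (p n : ℝ) / q n) atTop (𝓝 L))
    (n : ℕ) (hn : 2 ≤ n) : (q n : ℝ) * L - p n ≠ 0 := by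
  have h := TailSqueeze.lim_sub_ne_zero (fun n => (p n : ℝ) / q n) 2 (θ := 1045 / 796 ^ 2)
    (by norm_num) (by norm_num) hL step_contraction n hn (step_ne_zero n hn)
  have hq : (q n : ℝ) ≠ 0 := by
    have := (ratio_bounds n hn).1
    unfold u at this
    intro h0; rw [h0, mul_zero] at this; exact lt_irrefl _ this
  intro h0
  apply h
  field_simp
  linarith

/-- **Exact approximation rate**: if `pₙ/qₙ → L` then `log|L - pₙ/qₙ|/n → log ν - 2 log|μ| = -8.856014…`. -/
theorem tendsto_log_abs_sub_div_of_tendsto (hL : Tendsto (fun n : ℕ => (p n : ℝ) / q n) atTop (𝓝 L))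
    {ν : ℝ} (hν : ν ^ 3 = 752 * ν ^ 2 + 37888 * ν + (-256)) (hge : 195 ≤ ν)
    {μ : ℝ} (hμ : charPoly μ = 0) (hle : μ ≤ -796) :
    Tendsto (fun n : ℕ => Real.log |L - (p n : ℝ) / q n| / n) atTop
      (𝓝 (Real.log ν - 2 * Real.log |μ|)) :=
  TailSqueeze.tendsto_log_abs_lim_sub_div (fun n => (p n : ℝ) / q n) 2 (θ := 1045 / 796 ^ 2)
    (by norm_num) (by norm_num) hL step_contraction step_ne_zero (tendsto_log_abs_step_div hν hge hμ hle)

/-- **Exact decay of the forms**: if `pₙ/qₙ → L` then `log|qₙL - pₙ|/n → log ν - log|μ| = -1.08608…`. -/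
theorem tendsto_log_abs_form_div_of_tendsto (hL : Tendsto (fun n : ℕ => (p n : ℝ) / q n) atTop (𝓝 L))
    {ν : ℝ} (hν : ν ^ 3 = 752 * ν ^ 2 + 37888 * ν + (-256)) (hge : 195 ≤ ν)
    {μ : ℝ} (hμ : charPoly μ = 0) (hle : μ ≤ -796) :
    Tendsto (fun n : ℕ => Real.log |(q n : ℝ) * L - p n| / n) atTop
      (𝓝 (Real.log ν - Real.log |μ|)) := by
  have h := (tendsto_log_abs_q_div hμ hle).add (tendsto_log_abs_sub_div_of_tendsto hL hν hge hμ hle)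
  have e : Real.log |μ| + (Real.log ν - 2 * Real.log |μ|) = Real.log ν - Real.log |μ| := by ring
  rw [e] at h
  refine h.congr' ?_
  filter_upwards [eventually_ge_atTop 2] with n hn
  have hq : (q n : ℝ) ≠ 0 := by
    have := (ratio_bounds n hn).1
    unfold u at this
    intro h0; rw [h0, mul_zero] at this; exact lt_irrefl _ this
  have hid : (q n : ℝ) * L - p n = (q n : ℝ) * (L - (p n : ℝ) / q n) := by field_simp
  have hne : L - (p n : ℝ) / q n ≠ 0 := by
    intro h0
    exact form_ne_zero_of_tendsto hL n hn (by rw [hid, h0, mul_zero])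
  rw [hid, abs_mul, Real.log_mul (abs_ne_zero.2 hq) (abs_ne_zero.2 hne), add_div]

/-! ### The `ζ(3)` side: `p̃ₙ/qₙ` -/

/-- One telescoping step of the `ζ(3)`-approximants: for `n ≥ 3`,
`|p̃_{n+1}/q_{n+1} - p̃ₙ/qₙ| = Ztₙ / (|qₙ| |q_{n+1}|)`. -/
theorem abs_ratio_step_tilde_eq (n : ℕ) (hn : 3 ≤ n) :
    |(ptilde (n + 1) : ℝ) / q (n + 1) - (ptilde n : ℝ) / q n| =
      Zt n / (|(q n : ℝ)| * |(q (n + 1) : ℝ)|) := by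
  have hq0 : (q n : ℝ) ≠ 0 := by
    have := (ratio_bounds n (by omega)).1
    unfold u at this
    intro h; rw [h, mul_zero] at this; exact lt_irrefl _ this
  have hq1 : (q (n + 1) : ℝ) ≠ 0 := by
    have := (ratio_bounds (n + 1) (by omega)).1
    unfold u at this
    intro h; rw [h, mul_zero] at this; exact lt_irrefl _ this
  rw [← abs_casoratian_tilde_eq_Zt n hn, div_sub_div _ _ hq1 hq0, abs_div, abs_mul]
  congr 1
  · congr 1; ring
  · exact mul_comm _ _

/-- Exact rate of the `ζ(3)`-steps: `log|p̃_{n+1}/q_{n+1} - p̃ₙ/qₙ|/n → log ν - 2 log|μ|`. -/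
theorem tendsto_log_abs_step_tilde_div {ν : ℝ} (hν : ν ^ 3 = 752 * ν ^ 2 + 37888 * ν + (-256))
    (hge : 195 ≤ ν) {μ : ℝ} (hμ : charPoly μ = 0) (hle : μ ≤ -796) :
    Tendsto (fun n : ℕ => Real.log |(ptilde (n + 1) : ℝ) / q (n + 1) - (ptilde n : ℝ) / q n| / n) atTop
      (𝓝 (Real.log ν - 2 * Real.log |μ|)) := by
  have h := ((tendsto_log_Zt_div hν hge).sub (tendsto_log_abs_q_div hμ hle)).sub
    (tendsto_log_abs_q_succ_div hμ hle)
  have e : Real.log ν - Real.log |μ| - Real.log |μ| = Real.log ν - 2 * Real.log |μ| := by ring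
  rw [e] at h
  refine h.congr' ?_
  filter_upwards [eventually_ge_atTop 3] with n hn
  have hZ := (Zt_ratio_bounds n hn).1
  have hq0 : 0 < |(q n : ℝ)| := by rw [abs_q_eq_u n (by omega)]; exact (ratio_bounds n (by omega)).1
  have hq1 : 0 < |(q (n + 1) : ℝ)| := by
    rw [abs_q_eq_u (n + 1) (by omega)]; exact (ratio_bounds (n + 1) (by omega)).1
  rw [abs_ratio_step_tilde_eq n hn, Real.log_div hZ.ne' (mul_pos hq0 hq1).ne',
    Real.log_mul hq0.ne' hq1.ne']
  ring

/-- The `ζ(3)`-steps contract: factor `1045/796²` for `k ≥ 3`. -/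
theorem step_tilde_contraction (k : ℕ) (hk : 3 ≤ k) :
    |(ptilde (k + 2) : ℝ) / q (k + 2) - (ptilde (k + 1) : ℝ) / q (k + 1)| ≤
      1045 / 796 ^ 2 * |(ptilde (k + 1) : ℝ) / q (k + 1) - (ptilde k : ℝ) / q k| := by
  have hZ := Zt_ratio_bounds k hk
  have hq0 : 0 < |(q k : ℝ)| := by rw [abs_q_eq_u k (by omega)]; exact (ratio_bounds k (by omega)).1
  have hq1 : 0 < |(q (k + 1) : ℝ)| := by rw [abs_q_eq_u (k + 1) (by omega)]; exact (ratio_bounds (k + 1) (by omega)).1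
  have hq2 : 0 < |(q (k + 2) : ℝ)| := by rw [abs_q_eq_u (k + 2) (by omega)]; exact (ratio_bounds (k + 2) (by omega)).1
  have hg1 := (abs_q_succ_bounds k (by omega)).1
  have hg2 := (abs_q_succ_bounds (k + 1) (by omega)).1
  rw [show k + 1 + 1 = k + 2 by ring] at hg2
  have hq2' : (796 : ℝ) ^ 2 * |(q k : ℝ)| ≤ |(q (k + 2) : ℝ)| := by nlinarith
  rw [show k + 2 = k + 1 + 1 by ring, abs_ratio_step_tilde_eq (k + 1) (by omega),
    abs_ratio_step_tilde_eq k hk, show k + 1 + 1 = k + 2 by ring]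
  calc Zt (k + 1) / (|(q (k + 1) : ℝ)| * |(q (k + 2) : ℝ)|)
      ≤ 1045 * Zt k / (|(q (k + 1) : ℝ)| * ((796 : ℝ) ^ 2 * |(q k : ℝ)|)) :=
        div_le_div₀ (by linarith [hZ.1]) hZ.2.2 (by positivity) (mul_le_mul_of_nonneg_left hq2' hq1.le)
    _ = 1045 / 796 ^ 2 * (Zt k / (|(q k : ℝ)| * |(q (k + 1) : ℝ)|)) := by
        field_simp

/-- The `ζ(3)`-steps do not vanish (`n ≥ 3`). -/
theorem step_tilde_ne_zero (k : ℕ) (hk : 3 ≤ k) :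
    (ptilde (k + 1) : ℝ) / q (k + 1) ≠ (ptilde k : ℝ) / q k := by
  intro h
  have h1 := abs_ratio_step_tilde_eq k hk
  rw [h, sub_self, abs_zero] at h1
  have hZ := (Zt_ratio_bounds k hk).1
  have hq0 : 0 < |(q k : ℝ)| := by rw [abs_q_eq_u k (by omega)]; exact (ratio_bounds k (by omega)).1
  have hq1 : 0 < |(q (k + 1) : ℝ)| := by rw [abs_q_eq_u (k + 1) (by omega)]; exact (ratio_bounds (k + 1) (by omega)).1
  have : 0 < Zt k / (|(q k : ℝ)| * |(q (k + 1) : ℝ)|) := div_pos hZ (mul_pos hq0 hq1)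
  linarith

/-- **Non-vanishing, `ζ(3)` side**: if `p̃ₙ/qₙ → L'` then `qₙL' - p̃ₙ ≠ 0` for every `n ≥ 3`. -/
theorem form_tilde_ne_zero_of_tendsto {L' : ℝ}
    (hL : Tendsto (fun n : ℕ => (ptilde n : ℝ) / q n) atTop (𝓝 L')) (n : ℕ) (hn : 3 ≤ n) :
    (q n : ℝ) * L' - ptilde n ≠ 0 := by
  have h := TailSqueeze.lim_sub_ne_zero (fun n => (ptilde n : ℝ) / q n) 3 (θ := 1045 / 796 ^ 2)
    (by norm_num) (by norm_num) hL step_tilde_contraction n hn (step_tilde_ne_zero n hn)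
  have hq : (q n : ℝ) ≠ 0 := by
    have := (ratio_bounds n (by omega)).1
    unfold u at this
    intro h0; rw [h0, mul_zero] at this; exact lt_irrefl _ this
  intro h0
  apply h
  field_simp
  linarith

/-- **Exact decay, `ζ(3)` side**: if `p̃ₙ/qₙ → L'` then `log|qₙL' - p̃ₙ|/n → log ν - log|μ|`. -/
theorem tendsto_log_abs_form_tilde_div_of_tendsto {L' : ℝ}
    (hL : Tendsto (fun n : ℕ => (ptilde n : ℝ) / q n) atTop (𝓝 L'))
    {ν : ℝ} (hν : ν ^ 3 = 752 * ν ^ 2 + 37888 * ν + (-256)) (hge : 195 ≤ ν)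
    {μ : ℝ} (hμ : charPoly μ = 0) (hle : μ ≤ -796) :
    Tendsto (fun n : ℕ => Real.log |(q n : ℝ) * L' - ptilde n| / n) atTop
      (𝓝 (Real.log ν - Real.log |μ|)) := by
  have hsub := TailSqueeze.tendsto_log_abs_lim_sub_div (fun n => (ptilde n : ℝ) / q n) 3
    (θ := 1045 / 796 ^ 2) (by norm_num) (by norm_num) hL step_tilde_contraction step_tilde_ne_zero
    (tendsto_log_abs_step_tilde_div hν hge hμ hle)
  have h := (tendsto_log_abs_q_div hμ hle).add hsub
  have e : Real.log |μ| + (Real.log ν - 2 * Real.log |μ|) = Real.log ν - Real.log |μ| := by ring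
  rw [e] at h
  refine h.congr' ?_
  filter_upwards [eventually_ge_atTop 3] with n hn
  have hq : (q n : ℝ) ≠ 0 := by
    have := (ratio_bounds n (by omega)).1
    unfold u at this
    intro h0; rw [h0, mul_zero] at this; exact lt_irrefl _ this
  have hid : (q n : ℝ) * L' - ptilde n = (q n : ℝ) * (L' - (ptilde n : ℝ) / q n) := by field_simp
  have hne : L' - (ptilde n : ℝ) / q n ≠ 0 := by
    intro h0
    exact form_tilde_ne_zero_of_tendsto hL n hn (by rw [hid, h0, mul_zero])
  rw [hid, abs_mul, Real.log_mul (abs_ne_zero.2 hq) (abs_ne_zero.2 hne), add_div]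

end Zudilin2002Growth

end Summit.KontsevichZagierPeriods.Zeta5Search
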